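import Summits.HodgeConjecture.HodgeConjecture.Theorems.F0P3cStCharTSWeylHypWIFJac     -- ★ p849989 (LH2-p02 (g3)): `ae_isRegularElt_cmTorus` (a.e. torus element is regular; brings ★ `TorusDefs`: `torusChart`, `vanDijkWeight`)
import Summits.HodgeConjecture.HodgeConjecture.Theorems.F0P3cStCharTSTorusChartIso     -- ★ (LH6-p05 (g2)): `continuous_torusChart`, `isHaarMeasure_map_torusChart`
import Literature.NumberTheory.Rogawski1990.CMLocalAPacketMembers                      -- ★ `Gqs L v = (cmDatum L 3 Φ₃).Local v` (the organ's carrier spelling)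
import HarnessLib

/-!
# F0 · P3c · line LH6 «StCharTS» — «AESM-THETA★»: the integrand `Θ_χ(m) = Δ(ι m) · χ(ι m)` of (L1M) ∕ (L1M-up) is a.e.-strongly measurable on
# `M = E_vˣ × E¹_v` [Rogawski1990 §12.7 L. 12.7.2 (proof) p. 193; §1.6 p. 6]

Cell `pub/hodgecm-mathlib`, crux H413 = `stmt-HodgeConjecture-24833` (`--supports` lane, helper), route HCCMUnconditional; seat F0P2-p01 (g19) on the desk's deal
«AESM-THETA★» (F0P3-plan (g15) 2026-09-02T09:19Z) for the integrator LH6-p01 (g3)'s HEAD ₈ (TOR⁵).  THEOREMS ONLY, sorry-free, ★-only imports; no definition ∕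
instance ∕ notation ∕ named fact; count-neutral (a measure-theoretic junction).

WHAT THIS IS FOR.  ★ p850770 `F0P3cStCharTSL1MSplit.integrable_of_compactPart_bound_of_shell_decay` turns the two pointwise facts of print's proof of (L1M) into
`Integrable F μM` for ANY `F : M → ℂ` that is a.e.-strongly measurable (`hF`).  At the leaf's (TOR⁵) the functions are
`Θσ m = ((Δ(torusChart m)).re : ℂ) * χ_σ(ι m)` and `Θρ m = ((Δ(torusChart m)).re : ℂ) * χ_ρ^G(ι m)` (`Δ` = ★ `vanDijkWeight`, `ι m` = the torus chart read in
`Gqs L v = U(Φ₃)(L⁺_v)`), where the characters come with exactly the regularity the datum's sockets state: (M1) `𝔇.CharRegularity` — `χ_σ` is MEASURABLE on `G` (and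
locally constant on `G^{reg}`) — and (UPR) — `χ_ρ^G` is only LOCALLY CONSTANT ON `G^{reg}` (and locally integrable for `μG`, which says nothing on the `μG`-null torus).
This file supplies `hF` for both shapes:
* §1 `ae_isRegularElt_torusChart` — for every Haar measure `μM` on `M`, `ι m` is REGULAR for `μM`-a.e. `m` (★ `ae_isRegularElt_cmTorus` transported along the chart
  ★ `isHaarMeasure_map_torusChart`; [Rogawski1990 §12.5 p. 183], [HarishChandra1970 Lemma 42]);
* §2 `aestronglyMeasurable_of_ae_continuousAt` — GENERIC: a function continuous at `μ`-almost every point is a.e.-strongly measurable;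
* §3 `aestronglyMeasurable_comp_torusChart_of_eventuallyEq_regular` — `m ↦ χ(ι m)` is a.e.-strongly measurable for every `χ : Gqs L v → ℂ` that is locally constant at
  the regular elements (the (UPR) ∕ (M1) clause, read through the COMPAT `hreg : γ ∈ 𝔇.regG ↔ IsRegularElt γ`), and `…_of_measurable` — the same for `χ` measurable;
* §4 `aestronglyMeasurable_theta_of_eventuallyEq_regular` ∕ `aestronglyMeasurable_theta_of_measurable` — the (TOR⁵) integrands `Θ_χ` VERBATIM, given the weight's own
  a.e.-strong measurability `hW` (the «VDW-CORE» brick of F0P3a-p07 (g17): `Δ.re` is continuous on `T`) — and `…_of_measurable_weight` taking `Measurable (fun t => (Δ t).re)`.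
HONEST LABEL: HC_CM is proved only modulo the 7 printed citations (2 remaining: hLiu418 = stmt-HodgeConjecture-24832, h413 = stmt-HodgeConjecture-24833) until rung 0
closes; count-neutral.

## References
* [Rogawski1990] J. D. Rogawski, *Automorphic Representations of Unitary Groups in Three Variables*, Ann. of Math. Stud. 123 (1990): §12.7 L. 12.7.2 (proof) p. 193
  («the restriction of `D_G(γ)χ_π(γ)` to `M` is an integrable function»); §12.5 p. 183; §1.6 p. 6 (Harish-Chandra regularity of `χ_π`).
* [HarishChandra1970] Harish-Chandra, *Harmonic analysis on reductive p-adic groups*, LNM 162 (1970): Lemma 42 (regular elements are dense ∕ conull in a torus).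
* [DeitmarEchterhoff2014] A. Deitmar, S. Echterhoff, *Principles of Harmonic Analysis*, 2nd ed. (2014): §1.5 Thm. 1.5.3 (Haar measure transport).
-/

set_option autoImplicit false
-- the mandated namespace has the single-problem summit's repeated segment (`HodgeConjecture.HodgeConjecture`)
set_option linter.dupNamespace false

noncomputable section

open NumberField IsDedekindDomain MeasureTheory MeasureTheory.Measure Filter Topology Set
open scoped NNReal ENNReal
open Literature.NumberTheory.Automorphic Literature.NumberTheory.Automorphic.UnitaryGroup Literature.NumberTheory.Rogawski1990
open Summit.HodgeConjecture.HodgeConjecture.Cruxes.H413.F0P3cStCharTSTorusDefs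
open Summit.HodgeConjecture.HodgeConjecture.Cruxes.H413.F0P3cStCharTSTorusChartIso
open Summit.HodgeConjecture.HodgeConjecture.Cruxes.H413.F0P3cStCharTSWeylHypWIFJac

namespace Summit.HodgeConjecture.HodgeConjecture.Cruxes.H413.F0P3cStCharTSThetaAESM

/-! ## §2 (generic) Continuity at almost every point ⇒ a.e.-strong measurability -/

/-- **A function continuous at `μ`-almost every point is a.e.-strongly measurable** (source opens-measurable, target pseudo-metrisable): the continuity set contains a
measurable conull set `V`, `f` is continuous on `V`, so `f` is a.e.-strongly measurable for `μ.restrict V = μ`. [cite: DeitmarEchterhoff2014, §1.5 Thm. 1.5.3] -/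
theorem aestronglyMeasurable_of_ae_continuousAt {X E : Type*} [TopologicalSpace X] [MeasurableSpace X] [OpensMeasurableSpace X]
    [TopologicalSpace E] [TopologicalSpace.PseudoMetrizableSpace E] [SecondCountableTopology E]
    {f : X → E} {μ : Measure X} (h : ∀ᵐ x ∂μ, ContinuousAt f x) : AEStronglyMeasurable f μ := by
  obtain ⟨N, hNsub, hNmeas, hμN⟩ := exists_measurable_superset_of_null (ae_iff.1 h)
  have hcont : ContinuousOn f Nᶜ := fun x hx => (not_not.1 fun hx' => hx (hNsub hx')).continuousWithinAt
  have hV : μ.restrict Nᶜ = μ := restrict_eq_self_of_ae_mem (by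
    rw [ae_iff]
    simpa only [mem_compl_iff, not_not, setOf_mem_eq] using hμN)
  rw [← hV]
  exact hcont.aestronglyMeasurable hNmeas.compl

section CM

variable (L : Type) [Field L] [NumberField L] [IsCMField L] (v : HeightOneSpectrum (𝓞 ↥(maximalRealSubfield L)))

/-! ## §1 The chart point `ι m` is regular for `μM`-almost every `m ∈ M` -/

/-- **`ι m` IS REGULAR FOR `μM`-A.E. `m`** (`μM` any Haar measure on `M = E_vˣ × E¹_v`): ★ `ae_isRegularElt_cmTorus` for the Haar measure `ι_* μM` on `T` (★
`isHaarMeasure_map_torusChart`), pulled back along the measurable chart (Mathlib `ae_of_ae_map`).  [cite: Rogawski1990, §12.5 p. 183] [cite: HarishChandra1970, Lemma 42] -/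
theorem ae_isRegularElt_torusChart
    [MeasurableSpace ((LocalRing L v)ˣ × ↥(normOneUnits (conjLocal L (IsCMField.complexConj L) v)))] [BorelSpace ((LocalRing L v)ˣ × ↥(normOneUnits (conjLocal L (IsCMField.complexConj L) v)))]
    (μM : Measure ((LocalRing L v)ˣ × ↥(normOneUnits (conjLocal L (IsCMField.complexConj L) v)))) [μM.IsHaarMeasure] :
    ∀ᵐ m ∂μM, IsRegularElt (((torusChart L v m : ↥(cmBorelTriple L 3 v).M) : ↥(unitaryGroupOfForm (conjLocal L (IsCMField.complexConj L) v) (cmLocalForm L 3 v))) :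
      GL (Fin 3) (LocalRing L v)) := by
  letI : MeasurableSpace ↥(unitaryGroupOfForm (conjLocal L (IsCMField.complexConj L) v) (cmLocalForm L 3 v)) := borel _
  haveI : BorelSpace ↥(unitaryGroupOfForm (conjLocal L (IsCMField.complexConj L) v) (cmLocalForm L 3 v)) := ⟨rfl⟩
  haveI : (μM.map (torusChart L v)).IsHaarMeasure := isHaarMeasure_map_torusChart L v μM
  exact ae_of_ae_map (continuous_torusChart L v).measurable.aemeasurable (ae_isRegularElt_cmTorus L v (μM.map (torusChart L v)))

/-! ## §3 `m ↦ χ(ι m)` is a.e.-strongly measurable -/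

/-- The chart read in the organ's carrier `Gqs L v = U(Φ₃)(L⁺_v)` is continuous. [cite: Rogawski1990, §12.2 p. 173] -/
theorem continuous_torusChart_gqs :
    Continuous (X := (LocalRing L v)ˣ × ↥(normOneUnits (conjLocal L (IsCMField.complexConj L) v))) (Y := Gqs L v) fun m =>
      (((torusChart L v m : ↥(cmBorelTriple L 3 v).M) : ↥(unitaryGroupOfForm (conjLocal L (IsCMField.complexConj L) v) (cmLocalForm L 3 v))) : Gqs L v) :=
  continuous_subtype_val.comp (continuous_torusChart L v)

/-- **`m ↦ χ(ι m)` IS A.E.-STRONGLY MEASURABLE for `χ` LOCALLY CONSTANT AT THE REGULAR ELEMENTS** — the (UPR) ∕ (M1) local-constancy clause read through the COMPAT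
`γ ∈ 𝔇.regG ↔ IsRegularElt γ`; `μM` any Haar measure on `M`.  Proof: `χ` is continuous at every regular point, `ι` is continuous, `ι m` is regular a.e. (§1), §2.
[cite: Rogawski1990, §12.7 L. 12.7.2 (proof) p. 193; §1.6 p. 6] [cite: HarishChandra1970, Lemma 42] -/
theorem aestronglyMeasurable_comp_torusChart_of_eventuallyEq_regular
    [MeasurableSpace ((LocalRing L v)ˣ × ↥(normOneUnits (conjLocal L (IsCMField.complexConj L) v)))] [BorelSpace ((LocalRing L v)ˣ × ↥(normOneUnits (conjLocal L (IsCMField.complexConj L) v)))]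
    (μM : Measure ((LocalRing L v)ˣ × ↥(normOneUnits (conjLocal L (IsCMField.complexConj L) v)))) [μM.IsHaarMeasure]
    (χ : Gqs L v → ℂ) (hχ : ∀ g : Gqs L v, IsRegularElt (g.val : GL (Fin 3) (LocalRing L v)) → ∀ᶠ y in 𝓝 g, χ y = χ g) :
    AEStronglyMeasurable (fun m => χ (((torusChart L v m : ↥(cmBorelTriple L 3 v).M) : ↥(unitaryGroupOfForm (conjLocal L (IsCMField.complexConj L) v) (cmLocalForm L 3 v))) : Gqs L v)) μM := by
  refine aestronglyMeasurable_of_ae_continuousAt ?_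
  filter_upwards [ae_isRegularElt_torusChart L v μM] with m hm
  have hχc : ContinuousAt χ (((torusChart L v m : ↥(cmBorelTriple L 3 v).M) : ↥(unitaryGroupOfForm (conjLocal L (IsCMField.complexConj L) v) (cmLocalForm L 3 v))) : Gqs L v) :=
    tendsto_nhds_of_eventually_eq (hχ _ hm)
  exact ContinuousAt.comp (g := χ)
    (f := fun m' : (LocalRing L v)ˣ × ↥(normOneUnits (conjLocal L (IsCMField.complexConj L) v)) =>
      (((torusChart L v m' : ↥(cmBorelTriple L 3 v).M) : ↥(unitaryGroupOfForm (conjLocal L (IsCMField.complexConj L) v) (cmLocalForm L 3 v))) : Gqs L v))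
    hχc (continuous_torusChart_gqs L v).continuousAt

/-- **`m ↦ χ(ι m)` IS (A.E.-STRONGLY) MEASURABLE for `χ` MEASURABLE on `G`** — the (M1) measurability clause; Borel σ-algebras on `M` and on `Gqs L v` (the organ's
binders), any measure `μM`. [cite: Rogawski1990, §1.6 p. 6] -/
theorem aestronglyMeasurable_comp_torusChart_of_measurable
    [MeasurableSpace ((LocalRing L v)ˣ × ↥(normOneUnits (conjLocal L (IsCMField.complexConj L) v)))] [BorelSpace ((LocalRing L v)ˣ × ↥(normOneUnits (conjLocal L (IsCMField.complexConj L) v)))]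
    [MeasurableSpace (Gqs L v)] [BorelSpace (Gqs L v)]
    (μM : Measure ((LocalRing L v)ˣ × ↥(normOneUnits (conjLocal L (IsCMField.complexConj L) v))))
    (χ : Gqs L v → ℂ) (hχ : Measurable χ) :
    AEStronglyMeasurable (fun m => χ (((torusChart L v m : ↥(cmBorelTriple L 3 v).M) : ↥(unitaryGroupOfForm (conjLocal L (IsCMField.complexConj L) v) (cmLocalForm L 3 v))) : Gqs L v)) μM :=
  (hχ.comp (continuous_torusChart_gqs L v).measurable).aestronglyMeasurable

/-! ## §4 The (TOR⁵) integrands `Θ_χ(m) = Δ(ι m).re · χ(ι m)` -/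

/-- **«AESM-THETA★» (the (UPR) shape — `Θρ`, and `Θσ` through (M1)'s local constancy)**: for every Haar measure `μM` on `M = E_vˣ × E¹_v`, every `χ : Gqs L v → ℂ` locally
constant at the regular elements, and van Dijk's weight a.e.-strongly measurable along the chart (`hW`, the «VDW-CORE» input), the (TOR⁵) integrand
`m ↦ ((Δ(torusChart m)).re : ℂ) * χ(ι m)` is a.e.-strongly measurable — the `hF` of ★ `integrable_of_compactPart_bound_of_shell_decay`.
[cite: Rogawski1990, §12.7 L. 12.7.2 (proof) p. 193; §1.6 p. 6] [cite: HarishChandra1970, Lemma 42] -/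
theorem aestronglyMeasurable_theta_of_eventuallyEq_regular
    [MeasurableSpace ((LocalRing L v)ˣ × ↥(normOneUnits (conjLocal L (IsCMField.complexConj L) v)))] [BorelSpace ((LocalRing L v)ˣ × ↥(normOneUnits (conjLocal L (IsCMField.complexConj L) v)))]
    (μM : Measure ((LocalRing L v)ˣ × ↥(normOneUnits (conjLocal L (IsCMField.complexConj L) v)))) [μM.IsHaarMeasure]
    (hW : AEStronglyMeasurable (fun m => (((vanDijkWeight L v (torusChart L v m)).re : ℝ) : ℂ)) μM)
    (χ : Gqs L v → ℂ) (hχ : ∀ g : Gqs L v, IsRegularElt (g.val : GL (Fin 3) (LocalRing L v)) → ∀ᶠ y in 𝓝 g, χ y = χ g) :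
    AEStronglyMeasurable (fun m => (((vanDijkWeight L v (torusChart L v m)).re : ℝ) : ℂ) *
      χ (((torusChart L v m : ↥(cmBorelTriple L 3 v).M) : ↥(unitaryGroupOfForm (conjLocal L (IsCMField.complexConj L) v) (cmLocalForm L 3 v))) : Gqs L v)) μM :=
  hW.mul (aestronglyMeasurable_comp_torusChart_of_eventuallyEq_regular L v μM χ hχ)

/-- **«AESM-THETA★» (the (M1) shape — `Θσ`)**: for every measure `μM` on `M`, every MEASURABLE `χ : Gqs L v → ℂ` (Borel σ-algebra on `Gqs L v`) and van Dijk's weight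
a.e.-strongly measurable along the chart, `m ↦ ((Δ(torusChart m)).re : ℂ) * χ(ι m)` is a.e.-strongly measurable. [cite: Rogawski1990, §12.7 L. 12.7.2 (proof) p. 193; §1.6 p. 6] -/
theorem aestronglyMeasurable_theta_of_measurable
    [MeasurableSpace ((LocalRing L v)ˣ × ↥(normOneUnits (conjLocal L (IsCMField.complexConj L) v)))] [BorelSpace ((LocalRing L v)ˣ × ↥(normOneUnits (conjLocal L (IsCMField.complexConj L) v)))]
    [MeasurableSpace (Gqs L v)] [BorelSpace (Gqs L v)]
    (μM : Measure ((LocalRing L v)ˣ × ↥(normOneUnits (conjLocal L (IsCMField.complexConj L) v))))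
    (hW : AEStronglyMeasurable (fun m => (((vanDijkWeight L v (torusChart L v m)).re : ℝ) : ℂ)) μM)
    (χ : Gqs L v → ℂ) (hχ : Measurable χ) :
    AEStronglyMeasurable (fun m => (((vanDijkWeight L v (torusChart L v m)).re : ℝ) : ℂ) *
      χ (((torusChart L v m : ↥(cmBorelTriple L 3 v).M) : ↥(unitaryGroupOfForm (conjLocal L (IsCMField.complexConj L) v) (cmLocalForm L 3 v))) : Gqs L v)) μM :=
  hW.mul (aestronglyMeasurable_comp_torusChart_of_measurable L v μM χ hχ)

/-- **The weight input `hW` from a MEASURABLE weight on the torus** (e.g. from the continuity of `t ↦ (Δ t).re` on `T`, «VDW-CORE»): if `t ↦ (vanDijkWeight L v t).re` is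
measurable on `T` (Borel σ-algebra induced from one on `U(Φ₃)(L⁺_v)`), then `m ↦ ((Δ(torusChart m)).re : ℂ)` is (a.e.-strongly) measurable on `M`.
[cite: Rogawski1990, §12.7 L. 12.7.2 (proof) p. 193] -/
theorem aestronglyMeasurable_weight_of_measurable
    [MeasurableSpace ((LocalRing L v)ˣ × ↥(normOneUnits (conjLocal L (IsCMField.complexConj L) v)))] [BorelSpace ((LocalRing L v)ˣ × ↥(normOneUnits (conjLocal L (IsCMField.complexConj L) v)))]
    [MeasurableSpace ↥(unitaryGroupOfForm (conjLocal L (IsCMField.complexConj L) v) (cmLocalForm L 3 v))] [BorelSpace ↥(unitaryGroupOfForm (conjLocal L (IsCMField.complexConj L) v) (cmLocalForm L 3 v))]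
    (μM : Measure ((LocalRing L v)ˣ × ↥(normOneUnits (conjLocal L (IsCMField.complexConj L) v))))
    (hWm : Measurable fun t : ↥(cmBorelTriple L 3 v).M => (vanDijkWeight L v t).re) :
    AEStronglyMeasurable (fun m => (((vanDijkWeight L v (torusChart L v m)).re : ℝ) : ℂ)) μM :=
  (Complex.measurable_ofReal.comp (hWm.comp (continuous_torusChart L v).measurable)).aestronglyMeasurable

/-- **The weight input `hW` from CONTINUITY AT THE REGULAR TORUS POINTS** (the weaker «VDW-CORE» reading: `t ↦ (Δ t).re` continuous at every REGULAR `t ∈ T`; at the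
singular points `Δ = 0` and nothing is asked): then `m ↦ ((Δ(torusChart m)).re : ℂ)` is a.e.-strongly measurable for every Haar measure `μM` on `M` (§1 + §2).
[cite: Rogawski1990, §12.7 L. 12.7.2 (proof) p. 193] [cite: HarishChandra1970, Lemma 42] -/
theorem aestronglyMeasurable_weight_of_continuousAt_regular
    [MeasurableSpace ((LocalRing L v)ˣ × ↥(normOneUnits (conjLocal L (IsCMField.complexConj L) v)))] [BorelSpace ((LocalRing L v)ˣ × ↥(normOneUnits (conjLocal L (IsCMField.complexConj L) v)))]
    (μM : Measure ((LocalRing L v)ˣ × ↥(normOneUnits (conjLocal L (IsCMField.complexConj L) v)))) [μM.IsHaarMeasure]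
    (hWc : ∀ t : ↥(cmBorelTriple L 3 v).M,
      IsRegularElt (((t : ↥(unitaryGroupOfForm (conjLocal L (IsCMField.complexConj L) v) (cmLocalForm L 3 v))) : GL (Fin 3) (LocalRing L v))) →
        ContinuousAt (fun t' : ↥(cmBorelTriple L 3 v).M => (vanDijkWeight L v t').re) t) :
    AEStronglyMeasurable (fun m => (((vanDijkWeight L v (torusChart L v m)).re : ℝ) : ℂ)) μM := by
  refine aestronglyMeasurable_of_ae_continuousAt ?_
  filter_upwards [ae_isRegularElt_torusChart L v μM] with m hm
  exact Complex.continuous_ofReal.continuousAt.comp ((hWc _ hm).comp (continuous_torusChart L v).continuousAt)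

end CM

end Summit.HodgeConjecture.HodgeConjecture.Cruxes.H413.F0P3cStCharTSThetaAESM

end
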